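import Summits.QuantumAdvantage.QuantumAdvantage.Theorems.CubicForrelationNearExactIsExactEightLevelFourPartner
import Summits.QuantumAdvantage.QuantumAdvantage.Theorems.CubicForrelationNearExactIsExactEightTypeEPrep

/-!
# Crux `CubicForrelation.NearExactIsExact` (stmt-QuantumAdvantage-14043) — type E on 8 bits above `13/16`: the 2-FLAT PARITY on the split flat

Certificate seat `b2b-cforr-cert` (generation 2), rung `θ₈ = 13/16`.  HONEST FRAMING: a theorem about cubic Boolean functions on 8 bits (the
finite slice `n = 8` of the crux) — NOT summit progress.

FACT 1 of the type-E endgame (seat folder `PROOF-N8.md`, step T1): with `L := [⌊v/2⌋ odd] ⊕ f` (which vanishes off the split flat `Z = x₀ ⊕ V₀`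
by partner rigidity `ep_partner`), for `x ∈ Z` and `a, b ∈ V₀`: `L(x) ⊕ L(x⊕b) ⊕ L(x⊕a) ⊕ L(x⊕b⊕a) = 0` — i.e. `(−1)^L` is a `±`-character on `Z`.
Proof: the flat sum of `v` over the 4-flat `x ⊕ ⟨d₁, d₂, a, b⟩` (`dᵢ` transversal, `tep_dirs`) is `≡ 0 (mod 4)` (`ed_flat_sum_four`), the cubic `f` is even on
it (`ed_even_card_flat`); writing `v = 4q + 2[⌊v/2⌋ odd] + [v odd]` (`tep_mod_four`), the twelve odd points (`tep_parity_translate`) contribute `2[f] + 1`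
each and the four even points `2[⌊v/2⌋ odd]`, whence the parity.

References: C. Carlet, *Boolean Functions for Cryptography and Coding Theory*, CUP 2021, §4.1; S. Aaronson, A. Ambainis, *Forrelation*, SIAM J. Comput.
47 (2018) §1.1.1.  Everything below is proved from Mathlib and the tree; axioms are the standard three.
-/

set_option linter.dupNamespace false -- D-0017: single-problem summit ⇒ `QuantumAdvantage.QuantumAdvantage` by design

noncomputable section

namespace Summit.QuantumAdvantage.QuantumAdvantage.Theorems.CubicForrelation.NearExactIsExact

open Finset
open Literature.Computability.QuantumComplexity
open Literature.Computability.QuantumComplexity.BuzetChailloux (bxor zeroVec bxor_bxor_cancel_left bxor_zeroVec zeroVec_bxor bxor_comm)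
open Literature.Computability.QuantumComplexity.DerivativeWalsh (W)

/-- The points of the 4-flat `x ⊕ ⟨d₁,d₂,a,b⟩`: `x ⊕ ε₃b ⊕ ε₂a ⊕ ε₁d₂ ⊕ ε₀d₁`. [folklore] -/
theorem te_pt_four (x d₁ d₂ a b : Fin (4 + 4) → Bool) (e₀ e₁ e₂ e₃ : Bool) (t : Fin 0 → Bool) (ta : Fin 0 → Fin (4 + 4) → Bool) :
    (fun j => x j ^^ decide (Odd #(univ.filter fun i : Fin 4 =>
      (Fin.cons e₀ (Fin.cons e₁ (Fin.cons e₂ (Fin.cons e₃ t : Fin 1 → Bool) : Fin 2 → Bool) : Fin 3 → Bool) : Fin 4 → Bool) i &&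
      (Fin.cons d₁ (Fin.cons d₂ (Fin.cons a (Fin.cons b ta : Fin 1 → Fin (4 + 4) → Bool) : Fin 2 → Fin (4 + 4) → Bool)
        : Fin 3 → Fin (4 + 4) → Bool) : Fin 4 → Fin (4 + 4) → Bool) i j))) =
      fun j => (((x j ^^ (e₃ && b j)) ^^ (e₂ && a j)) ^^ (e₁ && d₂ j)) ^^ (e₀ && d₁ j) := by
  have h1 := erm_flatPt_cons x d₁ (Fin.cons d₂ (Fin.cons a (Fin.cons b ta : Fin 1 → Fin (4 + 4) → Bool) : Fin 2 → Fin (4 + 4) → Bool)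
      : Fin 3 → Fin (4 + 4) → Bool) e₀ (Fin.cons e₁ (Fin.cons e₂ (Fin.cons e₃ t : Fin 1 → Bool) : Fin 2 → Bool) : Fin 3 → Bool)
  have h2 := erm_flatPt_cons x d₂ (Fin.cons a (Fin.cons b ta : Fin 1 → Fin (4 + 4) → Bool) : Fin 2 → Fin (4 + 4) → Bool) e₁
    (Fin.cons e₂ (Fin.cons e₃ t : Fin 1 → Bool) : Fin 2 → Bool)
  have h3 := erm_flatPt_cons x a (Fin.cons b ta : Fin 1 → Fin (4 + 4) → Bool) e₂ (Fin.cons e₃ t : Fin 1 → Bool)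
  have h4 := erm_flatPt_cons x b ta e₃ t
  have h5 := tep_flatPt_nil x ta t
  rw [h1]
  funext j
  rw [congrFun h2 j, congrFun h3 j, congrFun h4 j, congrFun h5 j]

/-- Digit expansion with a Boolean second digit: `a = 4⌊⌊a/2⌋/2⌋ + 2[decide ⌊a/2⌋ odd] + [a odd]`. [folklore] -/
theorem te_mod_four' (a : ℤ) :
    a = 4 * (a / 2 / 2) + 2 * (if decide (Odd (a / 2)) = true then 1 else 0) + (if Odd a then 1 else 0) := by
  have h := tep_mod_four a
  by_cases hq : Odd (a / 2)
  · simp only [hq, decide_true, if_true] at h ⊢; exact h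
  · simp only [hq, decide_false, Bool.false_eq_true, if_false] at h ⊢; exact h

/-- Two indicator bits add up, modulo `2`, to the indicator of their xor. [folklore] -/
theorem te_ind_xor (β φ : Bool) :
    ((if β = true then (1 : ℤ) else 0) + (if φ = true then (1 : ℤ) else 0)) % 2 = (if (β ^^ φ) = true then (1 : ℤ) else 0) := by
  cases β <;> cases φ <;> decide

/-- Eight Booleans whose indicator sum is even have xor zero. [folklore] -/
theorem te_bool_of_even (β₀ φ₀ β₁ φ₁ β₂ φ₂ β₃ φ₃ : Bool)
    (h : ((((if β₀ = true then (1 : ℤ) else 0) + (if φ₀ = true then (1 : ℤ) else 0)) +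
      ((if β₁ = true then (1 : ℤ) else 0) + (if φ₁ = true then (1 : ℤ) else 0))) +
      (((if β₂ = true then (1 : ℤ) else 0) + (if φ₂ = true then (1 : ℤ) else 0)) +
      ((if β₃ = true then (1 : ℤ) else 0) + (if φ₃ = true then (1 : ℤ) else 0)))) % 2 = 0) :
    ((β₀ ^^ φ₀) ^^ (β₁ ^^ φ₁) ^^ (β₂ ^^ φ₂) ^^ (β₃ ^^ φ₃)) = false := by
  have x₀ := te_ind_xor β₀ φ₀
  have x₁ := te_ind_xor β₁ φ₁
  have x₂ := te_ind_xor β₂ φ₂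
  have x₃ := te_ind_xor β₃ φ₃
  generalize ((if β₀ = true then (1 : ℤ) else 0) + (if φ₀ = true then (1 : ℤ) else 0)) = A₀ at h x₀
  generalize ((if β₁ = true then (1 : ℤ) else 0) + (if φ₁ = true then (1 : ℤ) else 0)) = A₁ at h x₁
  generalize ((if β₂ = true then (1 : ℤ) else 0) + (if φ₂ = true then (1 : ℤ) else 0)) = A₂ at h x₂
  generalize ((if β₃ = true then (1 : ℤ) else 0) + (if φ₃ = true then (1 : ℤ) else 0)) = A₃ at h x₃
  generalize (β₀ ^^ φ₀) = s₀ at x₀ ⊢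
  generalize (β₁ ^^ φ₁) = s₁ at x₁ ⊢
  generalize (β₂ ^^ φ₂) = s₂ at x₂ ⊢
  generalize (β₃ ^^ φ₃) = s₃ at x₃ ⊢
  cases s₀ <;> cases s₁ <;> cases s₂ <;> cases s₃ <;>
    simp only [Bool.false_eq_true, if_false, if_true] at x₀ x₁ x₂ x₃ ⊢ <;> first | rfl | omega

/-- **FACT 1 (2-flat parity on the split flat).** In type E above `13/16` (`W_g = 16v`, even set `Z = x₀ ⊕ V₀` with `|V₀| = 64`, partner
rigidity `f = [⌊v/2⌋ odd]` off `Z`), the function `L := [⌊v/2⌋ odd] ⊕ f` satisfies `L(x) ⊕ L(x⊕b) ⊕ L(x⊕a) ⊕ L(x⊕b⊕a) = 0` for `x ∈ Z`,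
`a, b ∈ V₀`. [this work] -/
theorem te_fact1 (f g : (Fin (4 + 4) → Bool) → Bool) (hf : IsDegLeFun 3 f) (hg : IsDegLeFun 3 g)
    (v : (Fin (4 + 4) → Bool) → ℤ) (hv : ∀ x, W (fun y => signOf (g y)) x = (2 : ℝ) ^ 4 * (v x : ℝ))
    (V₀ : Finset (Fin (4 + 4) → Bool)) (x₀ : Fin (4 + 4) → Bool) (h0 : zeroVec ∈ V₀)
    (hadd : ∀ a ∈ V₀, ∀ b ∈ V₀, bxor a b ∈ V₀) (hcard : #V₀ = 64)
    (hZ : (univ.filter fun x => ¬ Odd (v x)) = V₀.image (bxor x₀))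
    (hfp : ∀ x, Odd (v x) → f x = decide (Odd (v x / 2)))
    {x a b : Fin (4 + 4) → Bool} (hx : ¬ Odd (v x)) (ha : a ∈ V₀) (hb : b ∈ V₀) :
    ((decide (Odd (v x / 2)) ^^ f x) ^^
      (decide (Odd (v (fun j => x j ^^ b j) / 2)) ^^ f (fun j => x j ^^ b j)) ^^
      (decide (Odd (v (fun j => x j ^^ a j) / 2)) ^^ f (fun j => x j ^^ a j)) ^^
      (decide (Odd (v (fun j => x j ^^ b j ^^ a j) / 2)) ^^ f (fun j => x j ^^ b j ^^ a j))) = false := by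
  classical
  obtain ⟨d₁, d₂, hd₁, hd₂, hd₁₂⟩ := tep_dirs V₀ (by omega)
  have hd₂₁ : bxor d₂ d₁ ∉ V₀ := by rwa [bxor_comm] at hd₁₂
  have hpar : ∀ c ∈ V₀, ∀ t : Fin (4 + 4) → Bool, ¬ Odd (v (bxor (bxor x c) t)) ↔ t ∈ V₀ :=
    fun c hc t => tep_parity_translate v V₀ x₀ hadd hZ hx hc t
  have hu : ∀ y, W (fun z => signOf (g z)) y = (2 : ℝ) ^ 3 * ((2 * v y : ℤ) : ℝ) := by
    intro y; rw [hv y]; push_cast; ring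
  have h8 := ed_flat_sum_four g (fun y => 2 * v y) hg hu x
    (Fin.cons d₁ (Fin.cons d₂ (Fin.cons a (Fin.cons b (fun i : Fin 0 => i.elim0) : Fin 1 → Fin (4 + 4) → Bool)
      : Fin 2 → Fin (4 + 4) → Bool) : Fin 3 → Fin (4 + 4) → Bool) : Fin 4 → Fin (4 + 4) → Bool)
  have hF := ed_even_card_flat f hf x
    (Fin.cons d₁ (Fin.cons d₂ (Fin.cons a (Fin.cons b (fun i : Fin 0 => i.elim0) : Fin 1 → Fin (4 + 4) → Bool)
      : Fin 2 → Fin (4 + 4) → Bool) : Fin 3 → Fin (4 + 4) → Bool) : Fin 4 → Fin (4 + 4) → Bool)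
  rw [card_filter] at hF
  rw [← mul_sum] at h8
  simp only [tep_sum_split, Fintype.sum_unique, te_pt_four, Bool.true_and, Bool.false_and, Bool.xor_false] at h8 hF
  rw [show (fun j : Fin (4 + 4) => x j) = x from rfl] at h8 hF
  obtain ⟨t8, ht8⟩ := h8
  obtain ⟨w, hw⟩ := hF
  zify at hw
  have q0 : ¬ Odd (v x) := by
    have h' := (hpar zeroVec h0 zeroVec).2 h0
    unfold bxor at h'
    try unfold zeroVec at h'
    try simp only [Bool.xor_false] at h'
    try simp only [← Bool.xor_assoc] at h'
    exact h'
  have q1 : ¬ Odd (v (fun j => x j ^^ b j)) := by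
    have h' := (hpar b hb zeroVec).2 h0
    unfold bxor at h'
    try unfold zeroVec at h'
    try simp only [Bool.xor_false] at h'
    try simp only [← Bool.xor_assoc] at h'
    exact h'
  have q2 : ¬ Odd (v (fun j => x j ^^ a j)) := by
    have h' := (hpar a ha zeroVec).2 h0
    unfold bxor at h'
    try unfold zeroVec at h'
    try simp only [Bool.xor_false] at h'
    try simp only [← Bool.xor_assoc] at h'
    exact h'
  have q3 : ¬ Odd (v (fun j => x j ^^ b j ^^ a j)) := by
    have h' := (hpar (bxor b a) (hadd b hb a ha) zeroVec).2 h0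
    unfold bxor at h'
    try unfold zeroVec at h'
    try simp only [Bool.xor_false] at h'
    try simp only [← Bool.xor_assoc] at h'
    exact h'
  have q4 : Odd (v (fun j => x j ^^ d₂ j)) := by
    have h' := hpar zeroVec h0 d₂
    unfold bxor at h'
    try unfold zeroVec at h'
    try simp only [Bool.xor_false] at h'
    try simp only [← Bool.xor_assoc] at h'
    by_contra hn
    exact hd₂ (h'.1 hn)
  have q5 : Odd (v (fun j => x j ^^ b j ^^ d₂ j)) := by
    have h' := hpar b hb d₂
    unfold bxor at h'
    try unfold zeroVec at h'
    try simp only [Bool.xor_false] at h'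
    try simp only [← Bool.xor_assoc] at h'
    by_contra hn
    exact hd₂ (h'.1 hn)
  have q6 : Odd (v (fun j => x j ^^ a j ^^ d₂ j)) := by
    have h' := hpar a ha d₂
    unfold bxor at h'
    try unfold zeroVec at h'
    try simp only [Bool.xor_false] at h'
    try simp only [← Bool.xor_assoc] at h'
    by_contra hn
    exact hd₂ (h'.1 hn)
  have q7 : Odd (v (fun j => x j ^^ b j ^^ a j ^^ d₂ j)) := by
    have h' := hpar (bxor b a) (hadd b hb a ha) d₂
    unfold bxor at h'
    try unfold zeroVec at h'
    try simp only [Bool.xor_false] at h'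
    try simp only [← Bool.xor_assoc] at h'
    by_contra hn
    exact hd₂ (h'.1 hn)
  have q8 : Odd (v (fun j => x j ^^ d₁ j)) := by
    have h' := hpar zeroVec h0 d₁
    unfold bxor at h'
    try unfold zeroVec at h'
    try simp only [Bool.xor_false] at h'
    try simp only [← Bool.xor_assoc] at h'
    by_contra hn
    exact hd₁ (h'.1 hn)
  have q9 : Odd (v (fun j => x j ^^ b j ^^ d₁ j)) := by
    have h' := hpar b hb d₁
    unfold bxor at h'
    try unfold zeroVec at h'
    try simp only [Bool.xor_false] at h'
    try simp only [← Bool.xor_assoc] at h'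
    by_contra hn
    exact hd₁ (h'.1 hn)
  have q10 : Odd (v (fun j => x j ^^ a j ^^ d₁ j)) := by
    have h' := hpar a ha d₁
    unfold bxor at h'
    try unfold zeroVec at h'
    try simp only [Bool.xor_false] at h'
    try simp only [← Bool.xor_assoc] at h'
    by_contra hn
    exact hd₁ (h'.1 hn)
  have q11 : Odd (v (fun j => x j ^^ b j ^^ a j ^^ d₁ j)) := by
    have h' := hpar (bxor b a) (hadd b hb a ha) d₁
    unfold bxor at h'
    try unfold zeroVec at h'
    try simp only [Bool.xor_false] at h'
    try simp only [← Bool.xor_assoc] at h'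
    by_contra hn
    exact hd₁ (h'.1 hn)
  have q12 : Odd (v (fun j => x j ^^ d₂ j ^^ d₁ j)) := by
    have h' := hpar zeroVec h0 (bxor d₂ d₁)
    unfold bxor at h'
    try unfold zeroVec at h'
    try simp only [Bool.xor_false] at h'
    try simp only [← Bool.xor_assoc] at h'
    by_contra hn
    exact hd₂₁ (h'.1 hn)
  have q13 : Odd (v (fun j => x j ^^ b j ^^ d₂ j ^^ d₁ j)) := by
    have h' := hpar b hb (bxor d₂ d₁)
    unfold bxor at h'
    try unfold zeroVec at h'
    try simp only [Bool.xor_false] at h'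
    try simp only [← Bool.xor_assoc] at h'
    by_contra hn
    exact hd₂₁ (h'.1 hn)
  have q14 : Odd (v (fun j => x j ^^ a j ^^ d₂ j ^^ d₁ j)) := by
    have h' := hpar a ha (bxor d₂ d₁)
    unfold bxor at h'
    try unfold zeroVec at h'
    try simp only [Bool.xor_false] at h'
    try simp only [← Bool.xor_assoc] at h'
    by_contra hn
    exact hd₂₁ (h'.1 hn)
  have q15 : Odd (v (fun j => x j ^^ b j ^^ a j ^^ d₂ j ^^ d₁ j)) := by
    have h' := hpar (bxor b a) (hadd b hb a ha) (bxor d₂ d₁)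
    unfold bxor at h'
    try unfold zeroVec at h'
    try simp only [Bool.xor_false] at h'
    try simp only [← Bool.xor_assoc] at h'
    by_contra hn
    exact hd₂₁ (h'.1 hn)
  have f4 : f (fun j => x j ^^ d₂ j) = decide (Odd (v (fun j => x j ^^ d₂ j) / 2)) := hfp _ q4
  have f5 : f (fun j => x j ^^ b j ^^ d₂ j) = decide (Odd (v (fun j => x j ^^ b j ^^ d₂ j) / 2)) := hfp _ q5
  have f6 : f (fun j => x j ^^ a j ^^ d₂ j) = decide (Odd (v (fun j => x j ^^ a j ^^ d₂ j) / 2)) := hfp _ q6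
  have f7 : f (fun j => x j ^^ b j ^^ a j ^^ d₂ j) = decide (Odd (v (fun j => x j ^^ b j ^^ a j ^^ d₂ j) / 2)) := hfp _ q7
  have f8 : f (fun j => x j ^^ d₁ j) = decide (Odd (v (fun j => x j ^^ d₁ j) / 2)) := hfp _ q8
  have f9 : f (fun j => x j ^^ b j ^^ d₁ j) = decide (Odd (v (fun j => x j ^^ b j ^^ d₁ j) / 2)) := hfp _ q9
  have f10 : f (fun j => x j ^^ a j ^^ d₁ j) = decide (Odd (v (fun j => x j ^^ a j ^^ d₁ j) / 2)) := hfp _ q10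
  have f11 : f (fun j => x j ^^ b j ^^ a j ^^ d₁ j) = decide (Odd (v (fun j => x j ^^ b j ^^ a j ^^ d₁ j) / 2)) := hfp _ q11
  have f12 : f (fun j => x j ^^ d₂ j ^^ d₁ j) = decide (Odd (v (fun j => x j ^^ d₂ j ^^ d₁ j) / 2)) := hfp _ q12
  have f13 : f (fun j => x j ^^ b j ^^ d₂ j ^^ d₁ j) = decide (Odd (v (fun j => x j ^^ b j ^^ d₂ j ^^ d₁ j) / 2)) := hfp _ q13
  have f14 : f (fun j => x j ^^ a j ^^ d₂ j ^^ d₁ j) = decide (Odd (v (fun j => x j ^^ a j ^^ d₂ j ^^ d₁ j) / 2)) := hfp _ q14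
  have f15 : f (fun j => x j ^^ b j ^^ a j ^^ d₂ j ^^ d₁ j) = decide (Odd (v (fun j => x j ^^ b j ^^ a j ^^ d₂ j ^^ d₁ j) / 2)) := hfp _ q15
  have m0 := te_mod_four' (v x)
  rw [if_neg q0] at m0
  have m1 := te_mod_four' (v (fun j => x j ^^ b j))
  rw [if_neg q1] at m1
  have m2 := te_mod_four' (v (fun j => x j ^^ a j))
  rw [if_neg q2] at m2
  have m3 := te_mod_four' (v (fun j => x j ^^ b j ^^ a j))
  rw [if_neg q3] at m3
  have m4 := te_mod_four' (v (fun j => x j ^^ d₂ j))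
  rw [if_pos q4] at m4
  have m5 := te_mod_four' (v (fun j => x j ^^ b j ^^ d₂ j))
  rw [if_pos q5] at m5
  have m6 := te_mod_four' (v (fun j => x j ^^ a j ^^ d₂ j))
  rw [if_pos q6] at m6
  have m7 := te_mod_four' (v (fun j => x j ^^ b j ^^ a j ^^ d₂ j))
  rw [if_pos q7] at m7
  have m8 := te_mod_four' (v (fun j => x j ^^ d₁ j))
  rw [if_pos q8] at m8
  have m9 := te_mod_four' (v (fun j => x j ^^ b j ^^ d₁ j))
  rw [if_pos q9] at m9
  have m10 := te_mod_four' (v (fun j => x j ^^ a j ^^ d₁ j))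
  rw [if_pos q10] at m10
  have m11 := te_mod_four' (v (fun j => x j ^^ b j ^^ a j ^^ d₁ j))
  rw [if_pos q11] at m11
  have m12 := te_mod_four' (v (fun j => x j ^^ d₂ j ^^ d₁ j))
  rw [if_pos q12] at m12
  have m13 := te_mod_four' (v (fun j => x j ^^ b j ^^ d₂ j ^^ d₁ j))
  rw [if_pos q13] at m13
  have m14 := te_mod_four' (v (fun j => x j ^^ a j ^^ d₂ j ^^ d₁ j))
  rw [if_pos q14] at m14
  have m15 := te_mod_four' (v (fun j => x j ^^ b j ^^ a j ^^ d₂ j ^^ d₁ j))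
  rw [if_pos q15] at m15
  rw [f4, f5, f6, f7, f8, f9, f10, f11, f12, f13, f14, f15] at hw
  refine te_bool_of_even _ _ _ _ _ _ _ _ ?_
  generalize (if decide (Odd (v x / 2)) = true then (1 : ℤ) else 0) = n0 at hw m0 ⊢
  generalize (if decide (Odd (v (fun j => x j ^^ b j) / 2)) = true then (1 : ℤ) else 0) = n1 at hw m1 ⊢
  generalize (if decide (Odd (v (fun j => x j ^^ a j) / 2)) = true then (1 : ℤ) else 0) = n2 at hw m2 ⊢
  generalize (if decide (Odd (v (fun j => x j ^^ b j ^^ a j) / 2)) = true then (1 : ℤ) else 0) = n3 at hw m3 ⊢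
  generalize (if decide (Odd (v (fun j => x j ^^ d₂ j) / 2)) = true then (1 : ℤ) else 0) = n4 at hw m4 ⊢
  generalize (if decide (Odd (v (fun j => x j ^^ b j ^^ d₂ j) / 2)) = true then (1 : ℤ) else 0) = n5 at hw m5 ⊢
  generalize (if decide (Odd (v (fun j => x j ^^ a j ^^ d₂ j) / 2)) = true then (1 : ℤ) else 0) = n6 at hw m6 ⊢
  generalize (if decide (Odd (v (fun j => x j ^^ b j ^^ a j ^^ d₂ j) / 2)) = true then (1 : ℤ) else 0) = n7 at hw m7 ⊢
  generalize (if decide (Odd (v (fun j => x j ^^ d₁ j) / 2)) = true then (1 : ℤ) else 0) = n8 at hw m8 ⊢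
  generalize (if decide (Odd (v (fun j => x j ^^ b j ^^ d₁ j) / 2)) = true then (1 : ℤ) else 0) = n9 at hw m9 ⊢
  generalize (if decide (Odd (v (fun j => x j ^^ a j ^^ d₁ j) / 2)) = true then (1 : ℤ) else 0) = n10 at hw m10 ⊢
  generalize (if decide (Odd (v (fun j => x j ^^ b j ^^ a j ^^ d₁ j) / 2)) = true then (1 : ℤ) else 0) = n11 at hw m11 ⊢
  generalize (if decide (Odd (v (fun j => x j ^^ d₂ j ^^ d₁ j) / 2)) = true then (1 : ℤ) else 0) = n12 at hw m12 ⊢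
  generalize (if decide (Odd (v (fun j => x j ^^ b j ^^ d₂ j ^^ d₁ j) / 2)) = true then (1 : ℤ) else 0) = n13 at hw m13 ⊢
  generalize (if decide (Odd (v (fun j => x j ^^ a j ^^ d₂ j ^^ d₁ j) / 2)) = true then (1 : ℤ) else 0) = n14 at hw m14 ⊢
  generalize (if decide (Odd (v (fun j => x j ^^ b j ^^ a j ^^ d₂ j ^^ d₁ j) / 2)) = true then (1 : ℤ) else 0) = n15 at hw m15 ⊢
  generalize (if f x = true then (1 : ℤ) else 0) = e0 at hw ⊢
  generalize (if f (fun j => x j ^^ b j) = true then (1 : ℤ) else 0) = e1 at hw ⊢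
  generalize (if f (fun j => x j ^^ a j) = true then (1 : ℤ) else 0) = e2 at hw ⊢
  generalize (if f (fun j => x j ^^ b j ^^ a j) = true then (1 : ℤ) else 0) = e3 at hw ⊢
  generalize v x / 2 / 2 = r0 at m0
  generalize v (fun j => x j ^^ b j) / 2 / 2 = r1 at m1
  generalize v (fun j => x j ^^ a j) / 2 / 2 = r2 at m2
  generalize v (fun j => x j ^^ b j ^^ a j) / 2 / 2 = r3 at m3
  generalize v (fun j => x j ^^ d₂ j) / 2 / 2 = r4 at m4
  generalize v (fun j => x j ^^ b j ^^ d₂ j) / 2 / 2 = r5 at m5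
  generalize v (fun j => x j ^^ a j ^^ d₂ j) / 2 / 2 = r6 at m6
  generalize v (fun j => x j ^^ b j ^^ a j ^^ d₂ j) / 2 / 2 = r7 at m7
  generalize v (fun j => x j ^^ d₁ j) / 2 / 2 = r8 at m8
  generalize v (fun j => x j ^^ b j ^^ d₁ j) / 2 / 2 = r9 at m9
  generalize v (fun j => x j ^^ a j ^^ d₁ j) / 2 / 2 = r10 at m10
  generalize v (fun j => x j ^^ b j ^^ a j ^^ d₁ j) / 2 / 2 = r11 at m11
  generalize v (fun j => x j ^^ d₂ j ^^ d₁ j) / 2 / 2 = r12 at m12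
  generalize v (fun j => x j ^^ b j ^^ d₂ j ^^ d₁ j) / 2 / 2 = r13 at m13
  generalize v (fun j => x j ^^ a j ^^ d₂ j ^^ d₁ j) / 2 / 2 = r14 at m14
  generalize v (fun j => x j ^^ b j ^^ a j ^^ d₂ j ^^ d₁ j) / 2 / 2 = r15 at m15
  omega

end Summit.QuantumAdvantage.QuantumAdvantage.Theorems.CubicForrelation.NearExactIsExact

end
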